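import Summits.Ventures.QEC.Census.CertCoverBatch
import Summits.Ventures.QEC.Census.BB.A1s_n192_k4_0fa3ae82.CoreDefs
import HarnessLib

set_option Elab.async false
set_option maxRecDepth 200000

/-!
# `[[192,4,18]]` one-level cover certificate — LEVEL-1→0 coset problems 21…30 (problem 1 excluded: `Prob1.lean`) as COMPACT data
(`ProbData`: U, f, σ, y₀, allow; qec-type-10 `CertCoverBatch.mkCoset` rebuilds each `CosetProb` in the kernel) + their verdict
`probsOK cov covR hx hx1 D1 lxd 16` (one `decide +kernel`). qec-search-9 g5 (lead block 170 (0)(c)); data from JSON `level10.problems`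
(sha256 08367568…). Data + decided check; KERNEL.
-/

namespace Summit.Ventures.QEC.Census.A1s_n192_k4_0fa3ae82

open Matrix Summit.Ventures.QEC.Census Literature.InformationTheory.QuantumCodes

/-- Problems 21…30 (10): `⟨U, f, σ, y₀, allow⟩`. -/
def probs00c : List ProbData := [
    ⟨4443082683472684032, 0, 0, 0, [0]⟩,
    ⟨4702041137396204164, 0, 1099520278528, 90071999006688900, []⟩,
    ⟨5899997403447100416, 1, 0, 0, [0, 32768, 2305843009213693952]⟩,
    ⟨5972617956028320768, 0, 0, 0, [0]⟩,
    ⟨7043911571359237120, 2, 0, 0, [0]⟩,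
    ⟨7116532123940457472, 1, 0, 0, [0, 65536, 72057594037927936]⟩,
    ⟨9304859050128762690, 0, 211106236858368, 9223512774343131136, [0]⟩,
    ⟨9349755403082416772, 1, 1099520278528, 54324672669434500, [0, 18446744073709551616, 2361183241434822606848]⟩,
    ⟨9440392542476304649, 1, 2199032233984, 844424963686665, [0, 18446744073709551616, 36893488147419103232]⟩,
    ⟨10475655174615663616, 0, 0, 0, [0]⟩]

set_option maxHeartbeats 400000000 in
/-- Every problem of this chunk passes (`mkCoset` elimination + `cosetOKD` + fast `σ` + depth + `BU`-evenness + label checks). -/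
theorem probs00c_ok : probsOK cov covR hx hx1 D1 lxd 16 probs00c = true := by
  decide +kernel

/-- Pointwise form. -/
theorem probs00c_all : ∀ x ∈ probs00c, probOK cov covR hx hx1 D1 lxd 16 x = true := by
  have h := probs00c_ok
  rwa [probsOK, List.all_eq_true] at h

end Summit.Ventures.QEC.Census.A1s_n192_k4_0fa3ae82
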